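import Summits.AtomisticToContinuum.Crystallization.Theorems.ChargedEnergyGapFlatUnit
import HarnessLib

/-!
(SPLIT FOR THE 400-LINE CAP by the landing lane, hand-2 g49: this file = part A; part B = `…ChargedEnergyGapTileUnit` imports it; same namespace, all FQNs unchanged.)
# §113M «TileUnit» — a window unit whose representative cells carry THEIR OWN transverse tilings, with a kernel-checked cover of the
frame box by the tile boxes (lens-3 g96, line 14231 ChargedEnergyGap / PricedLinkCensus r3, deciding leaf (T¹ᶜ)
`StencilChartLawQ 130 (1/60000000) 160 (3/100) (679/1000) (691/1000)`)

Imports tree (266) 113L «FlatUnit» (`StationCert.checkDXZ`, `StationCert.sphLaw_of_checkDXZ`, the mirror transport argument of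
`StationCert.sphLaw_swap12`) and through it 113I «MirrorUnit» (`Box3.swap12`, `StationRowsCert.symm12`, `relabel_one_zero`, `axp_one`),
113F «SphereRows» (`sphRows`), 113E «SphereCell» (`Box3`, `CoverTree`, `unitCube`, `sphere_cells_dispatch`) and NODE 111 «AxisWLOG»
(`tupleRelabel` and its invariances).

WHY (FINDING «TRANSVERSE-TILE COVER GAP», STATUS 2026-09-04).  A 113L unit carries ONE H-description `R`, so all its parts share one box; the
deep-band tilings of record cut the transverse pair `(T, F)` of BOTH axes `1, 2` at once, i.e. a tile certifies the 4-D block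
`{T₁, T₂ ∈ I} × {F₁, F₂ ∈ J}` and the union over a quadtree of such tiles is the DIAGONAL of `([tlo, thi] × [flo, fhi])²` only.
The law every unit exports (`ZUnit.soundM`) binds the box PER SLOT, so a cover of the band's frame box must reach the mixed blocks too.  This file makes
the transverse cover a CHECKED OBJECT: per representative cell a list of TILES (each a complete cell station on its own box: H-description,
diet rows, caps, bases, box leaves, BSP tree, slim bases) and a BSP CERTIFICATE `TileTree` that the tile boxes cover the unit's FRAME BOX
(slot-0 window × the band's full transverse extent on the four slots `(1,T) (1,F) (2,T) (2,F)` × centre band) up to regions the axis-0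
chamber empties (`T_a > F_a`; `T_a + F_a < lo (0,T) + lo (0,F)`; and, for a SELF-MIRROR cell flagged `half`, `T₂ < T₁`).  Mirror cells are
served by TUPLE TRANSPORT of the representative's law (`lawR_swap12`, the argument of 113L `sphLaw_swap12` one level up, with a side
condition carried along): no tile box need be `1 ↔ 2`-symmetric — only the FRAME is (`StationRowsCert.symm12`).

* §113M.1 `RBox` (a box of the seven depths), `TileTree`, ★ `TileTree.check`, ★★ `TileTree.check_sound`.
* §113M.2 ★★ `lawR_swap12`: the sphere-cell law over a frame `R`, unit `u`, cell `c` and side condition `S` transports to `c.swap12` with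
  side condition `S ∘ tupleRelabel 1 0`.
* §113M.3 `Tile`, `Rep`, `TileUnit`; checkers `Tile.check`, `Rep.check`, ★ `TileUnit.checkM`; ★★ `Rep.soundD` (tile dispatch),
  ★★ `Rep.sound` (the half-domain reduction for self-mirror cells), ★★★ `TileUnit.soundM` — the binders and the conclusion of 113F
  `SphUnit.sound` / 113L `ZUnit.soundM` EXACTLY (frame `U.R`, unit `U.u`), so the door cover (D4) consumes a tile unit like any unit;
  `TileUnit.soundM_of_all`; assembly helpers `Rep.check_of`, `TileUnit.checkM_of`.
* §113M.3 (cont.) ★ MUST-FAIL lemmas `Rep.check_eq_false_of_cover`, `TileUnit.checkM_eq_false_of_rep` (a unit whose tiles do not cover its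
  declared frame is rejected BY THE KERNEL); ★★ `ZUnit.tile`, `ZUnit.tile_check` (a landed 113L unit's part IS a checked tile, read off its
  landed `checkM` — batches 3–4 are consumed BY NAME as the diagonal leaves of a representative's cover); `Tile.all_check_cons`.
* §113M.4 [finite checks] a toy frame: the four diagonal quarter boxes miss a chamber point of the frame and their natural trees FAIL the
  cover check (must-fail); four SEMI-QUARTER boxes (axis `1` halved, axis `2` free) pass it and fail again with one tile shrunk (must-fail); an
  `offTF` leaf discards `T₁ > F₁`; `offHalf` is refused without the half flag and accepted with it; a representative naming a missing tile
  fails `Rep.check`.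

A unit FILE is data + kernel decisions, as for 113L: `def frameR : StationRowsCert := ⟨ρ0, ρ1, lo, hi, loC, hiC, [], [], []⟩` (row lists
unread), per tile `def tᵏᵢ : Tile := ⟨⟨tᵏᵢR, u, capLB, cap, bases, boxes, tree, caps⟩, tᵏᵢX, slim⟩` and ONE decision
`theorem tᵏᵢ_ok : tᵏᵢ.check frameR.rho0 frameR.rho1 u cellₖ = true := by decide +kernel`, per representative `def repₖ : Rep :=
⟨cellₖ, half, [tᵏ₀, …], tcoverₖ⟩` with `decide +kernel` on its flag and its `TileTree.check`,
`def U : TileUnit := ⟨frameR, u, cegCover, [rep₀, …]⟩`, `theorem U_ok : U.checkM = true` by `TileUnit.checkM_of` and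
`theorem U_law := U.soundM U_ok`.
[EQUIV (bookkeeping of WHICH boxes are certified; no estimate moved, no constant changed) · COUNT-CRITICAL · (T¹ᶜ) itself UNDECIDED.]
No `sorry`, no `set_option`, no instance, no notation.
-/

namespace Summit.AtomisticToContinuum.Crystallization.Theorems.ChargedEnergyGapChartDial

open scoped Classical
open Literature.MathematicalPhysics.StatisticalMechanics Literature.Geometry.DiscreteGeometry
open Summit.AtomisticToContinuum.Crystallization.Theses.PricedLinkCensus
open Summit.AtomisticToContinuum.Crystallization.Theorems.ChargedEnergyGapNegative

/-! ## §113M.1 Boxes of the seven depths and a kernel-decidable cover of a frame box by tile boxes -/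
section Boxes

/-- A box of the SEVEN DEPTHS (the six hole-vertex slots and the centre) with rational corners: the frame of a unit, the box of a tile, a
node of the cover certificate. -/
structure RBox where
  /-- hole-vertex slots, low corner -/
  lo : Fin 3 × Bool → ℚ
  /-- hole-vertex slots, high corner -/
  hi : Fin 3 × Bool → ℚ
  /-- centre depth, low end -/
  loC : ℚ
  /-- centre depth, high end -/
  hiC : ℚ

/-- The box of an H-description (110D); its slab and its row lists are not part of it. -/
def StationRowsCert.rbox (R : StationRowsCert) : RBox := ⟨R.lo, R.hi, R.loC, R.hiC⟩

/-- Replace the upper end of slot `q` by `m`. -/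
def RBox.setHi (B : RBox) (q : Fin 3 × Bool) (m : ℚ) : RBox := ⟨B.lo, fun q' => if q' = q then m else B.hi q', B.loC, B.hiC⟩

/-- Replace the lower end of slot `q` by `m`. -/
def RBox.setLo (B : RBox) (q : Fin 3 × Bool) (m : ℚ) : RBox := ⟨fun q' => if q' = q then m else B.lo q', B.hi, B.loC, B.hiC⟩

/-- Replace the upper end of the centre by `m`. -/
def RBox.setHiC (B : RBox) (m : ℚ) : RBox := ⟨B.lo, B.hi, B.loC, m⟩

/-- Replace the lower end of the centre by `m`. -/
def RBox.setLoC (B : RBox) (m : ℚ) : RBox := ⟨B.lo, B.hi, m, B.hiC⟩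

/-- `B ⊆ T` (fourteen comparisons of rationals). -/
def RBox.inside (B T : RBox) : Bool :=
  decide (∀ q : Fin 3 × Bool, T.lo q ≤ B.lo q ∧ B.hi q ≤ T.hi q) && decide (T.loC ≤ B.loC ∧ B.hiC ≤ T.hiC)

/-- A BSP certificate that a list of tile boxes covers the chamber part of a frame box: leaves name a tile (`tile j`), or discard a node
the axis-`0` chamber empties — `offTF a`: `hi (a,F) < lo (a,T)` against the pole order `T_a ≤ F_a`; `offSum a`: `hi (a,T) + hi (a,F) <
lo (0,T) + lo (0,F)` against `poleSum 0 ≤ poleSum a`; `offHalf`: `hi (2,T) < lo (1,T)` against the half-domain condition `T₁ ≤ T₂`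
(licensed only when the checker's `half` flag is set); inner nodes split a slot (`split q m`: left `x_q ≤ m`, right `m ≤ x_q`) or the centre
(`splitC m`). -/
inductive TileTree where
  | tile (j : ℕ) : TileTree
  | offTF (a : Fin 3) : TileTree
  | offSum (a : Fin 3) : TileTree
  | offHalf : TileTree
  | split (q : Fin 3 × Bool) (m : ℚ) (left right : TileTree) : TileTree
  | splitC (m : ℚ) (left right : TileTree) : TileTree

/-- ★ THE TILE COVER CHECKER over the node box `B`: every `tile` leaf box lies inside its named tile box, every `off…` leaf box is emptied
by the chamber (resp. the half-domain condition when `half`), recursively through the splits. -/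
def TileTree.check (tiles : List RBox) (half : Bool) : TileTree → RBox → Bool
  | .tile j, B => match tiles[j]? with
    | some T => B.inside T
    | none => false
  | .offTF a, B => decide (B.hi (a, false) < B.lo (a, true))
  | .offSum a, B => decide (B.hi (a, true) + B.hi (a, false) < B.lo (0, true) + B.lo (0, false))
  | .offHalf, B => half && decide (B.hi (2, true) < B.lo (1, true))
  | .split q m tl tr, B => TileTree.check tiles half tl (B.setHi q m) && TileTree.check tiles half tr (B.setLo q m)
  | .splitC m tl tr, B => TileTree.check tiles half tl (B.setHiC m) && TileTree.check tiles half tr (B.setLoC m)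

/-- [formal bookkeeping] slot membership after cutting the upper end of slot `q`. -/
theorem RBox.mem_setHi {B : RBox} {q : Fin 3 × Bool} {m : ℚ} {dt : (Fin 3 → ℤ) → ℝ}
    (h : ∀ q', castW B.lo q' ≤ dt (holeVertex 0 q') ∧ dt (holeVertex 0 q') ≤ castW B.hi q') (hm : dt (holeVertex 0 q) ≤ m) :
    ∀ q', castW (B.setHi q m).lo q' ≤ dt (holeVertex 0 q') ∧ dt (holeVertex 0 q') ≤ castW (B.setHi q m).hi q' := by
  intro q'
  refine ⟨(h q').1, ?_⟩
  show dt (holeVertex 0 q') ≤ ((if q' = q then m else B.hi q' : ℚ) : ℝ)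
  split_ifs with e
  · rw [e]; exact hm
  · exact (h q').2

/-- [formal bookkeeping] slot membership after cutting the lower end of slot `q`. -/
theorem RBox.mem_setLo {B : RBox} {q : Fin 3 × Bool} {m : ℚ} {dt : (Fin 3 → ℤ) → ℝ}
    (h : ∀ q', castW B.lo q' ≤ dt (holeVertex 0 q') ∧ dt (holeVertex 0 q') ≤ castW B.hi q') (hm : (m : ℝ) ≤ dt (holeVertex 0 q)) :
    ∀ q', castW (B.setLo q m).lo q' ≤ dt (holeVertex 0 q') ∧ dt (holeVertex 0 q') ≤ castW (B.setLo q m).hi q' := by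
  intro q'
  refine ⟨?_, (h q').2⟩
  show ((if q' = q then m else B.lo q' : ℚ) : ℝ) ≤ dt (holeVertex 0 q')
  split_ifs with e
  · rw [e]; exact hm
  · exact (h q').1

/-- [formal bookkeeping] `inside` is containment (slots and centre). -/
theorem RBox.mem_of_inside {B T : RBox} (h : B.inside T = true) {dt : (Fin 3 → ℤ) → ℝ}
    (hb : ∀ q, castW B.lo q ≤ dt (holeVertex 0 q) ∧ dt (holeVertex 0 q) ≤ castW B.hi q) (hc : (B.loC : ℝ) ≤ dt 0 ∧ dt 0 ≤ B.hiC) :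
    (∀ q, castW T.lo q ≤ dt (holeVertex 0 q) ∧ dt (holeVertex 0 q) ≤ castW T.hi q) ∧ ((T.loC : ℝ) ≤ dt 0 ∧ dt 0 ≤ T.hiC) := by
  simp only [RBox.inside, Bool.and_eq_true, decide_eq_true_eq] at h
  obtain ⟨hq, hc1, hc2⟩ := h
  refine ⟨fun q => ⟨le_trans ?_ (hb q).1, le_trans (hb q).2 ?_⟩, le_trans (by exact_mod_cast hc1) hc.1, le_trans hc.2 (by exact_mod_cast hc2)⟩
  · rw [castW_apply, castW_apply]; exact_mod_cast (hq q).1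
  · rw [castW_apply, castW_apply]; exact_mod_cast (hq q).2

/-- ★★ **SOUNDNESS OF THE TILE COVER CHECKER**: a tree checked over the node box `B` sends every tuple whose seven depths lie in `B`, in
the axis-`0` chamber (`poleSum 0 ≤ poleSum 1, poleSum 0 ≤ poleSum 2`, pole order `T_a ≤ F_a`) and — when `half` — with `T₁ ≤ T₂`, into
some listed tile box. -/
theorem TileTree.check_sound (tiles : List RBox) (half : Bool) : ∀ (t : TileTree) (B : RBox), t.check tiles half B = true →
    ∀ dt : (Fin 3 → ℤ) → ℝ, (∀ q, castW B.lo q ≤ dt (holeVertex 0 q) ∧ dt (holeVertex 0 q) ≤ castW B.hi q) →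
      ((B.loC : ℝ) ≤ dt 0 ∧ dt 0 ≤ B.hiC) → poleSum dt 0 ≤ poleSum dt 1 → poleSum dt 0 ≤ poleSum dt 2 →
      (∀ a : Fin 3, dt (holeVertex 0 (a, true)) ≤ dt (holeVertex 0 (a, false))) →
      (half = true → dt (holeVertex 0 (1, true)) ≤ dt (holeVertex 0 (2, true))) →
      ∃ T ∈ tiles, (∀ q, castW T.lo q ≤ dt (holeVertex 0 q) ∧ dt (holeVertex 0 q) ≤ castW T.hi q) ∧
        ((T.loC : ℝ) ≤ dt 0 ∧ dt 0 ≤ T.hiC)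
  | .tile j, B, h, dt, hb, hc, _, _, _, _ => by
    simp only [TileTree.check] at h
    cases hj : tiles[j]? with
    | none => rw [hj] at h; exact absurd h (by simp)
    | some T => rw [hj] at h; exact ⟨T, List.mem_of_getElem? hj, RBox.mem_of_inside h hb hc⟩
  | .offTF a, B, h, dt, hb, _, _, _, hchp, _ => by
    simp only [TileTree.check, decide_eq_true_eq] at h
    exfalso
    have h1 := (hb (a, false)).2
    have h2 := (hb (a, true)).1
    rw [castW_apply] at h1 h2
    have h' : ((B.hi (a, false) : ℚ) : ℝ) < B.lo (a, true) := by exact_mod_cast h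
    linarith [hchp a]
  | .offSum a, B, h, dt, hb, _, hch1, hch2, _, _ => by
    simp only [TileTree.check, decide_eq_true_eq] at h
    exfalso
    have hcha : ∀ a' : Fin 3, poleSum dt 0 ≤ poleSum dt a' := by
      intro a'
      fin_cases a'
      · exact le_rfl
      · exact hch1
      · exact hch2
    have hca := hcha a
    unfold poleSum at hca
    have h1 := (hb (a, true)).2
    have h2 := (hb (a, false)).2
    have h3 := (hb (0, true)).1
    have h4 := (hb (0, false)).1
    rw [castW_apply] at h1 h2 h3 h4
    have h' : ((B.hi (a, true) : ℚ) : ℝ) + B.hi (a, false) < B.lo (0, true) + B.lo (0, false) := by exact_mod_cast h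
    linarith
  | .offHalf, B, h, dt, hb, _, _, _, _, hhalf => by
    simp only [TileTree.check, Bool.and_eq_true, decide_eq_true_eq] at h
    exfalso
    have h1 := (hb (2, true)).2
    have h2 := (hb (1, true)).1
    rw [castW_apply] at h1 h2
    have h' : ((B.hi (2, true) : ℚ) : ℝ) < B.lo (1, true) := by exact_mod_cast h.2
    linarith [hhalf h.1]
  | .split q m tl tr, B, h, dt, hb, hc, hch1, hch2, hchp, hhalf => by
    simp only [TileTree.check, Bool.and_eq_true] at h
    rcases le_or_gt (dt (holeVertex 0 q)) m with hle | hgt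
    · exact TileTree.check_sound tiles half tl _ h.1 dt (RBox.mem_setHi hb hle) hc hch1 hch2 hchp hhalf
    · exact TileTree.check_sound tiles half tr _ h.2 dt (RBox.mem_setLo hb hgt.le) hc hch1 hch2 hchp hhalf
  | .splitC m tl tr, B, h, dt, hb, hc, hch1, hch2, hchp, hhalf => by
    simp only [TileTree.check, Bool.and_eq_true] at h
    rcases le_or_gt (dt 0) m with hle | hgt
    · exact TileTree.check_sound tiles half tl _ h.1 dt hb ⟨hc.1, hle⟩ hch1 hch2 hchp hhalf
    · exact TileTree.check_sound tiles half tr _ h.2 dt hb ⟨hgt.le, hc.2⟩ hch1 hch2 hchp hhalf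

end Boxes

/-! ## §113M.2 Mirror transport of a framed sphere-cell law with a side condition -/
section Swap

/-- [formal bookkeeping] a cell with equal axis-`1` and axis-`2` coordinates is its own mirror. -/
theorem Box3.swap12_eq_self {c : Box3} (h1 : c.l1 = c.l2) (h2 : c.h1 = c.h2) : c.swap12 = c := by
  cases c
  simp only at h1 h2
  subst h1 h2
  rfl

/-- ★★ MIRROR TRANSPORT, LAW TO LAW, of the sphere-cell law OVER A FRAME (slab and box of `R`, unit `u`) WITH A SIDE CONDITION `S` on the
tuple (the argument of 113I `sound_dietSph_swap12` / 113L `sphLaw_swap12`): over a `1 ↔ 2`-symmetric frame box with `0 < ρ0`, the law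
on `cell` for the tuples satisfying `S` gives the law on `cell.swap12` for the tuples whose relabelling `tupleRelabel 1 0` satisfies `S`. -/
theorem lawR_swap12 {R : StationRowsCert} {u : ℚ} {cell : Box3} (S : ((Fin 3 → ℤ) → ℝ) → Prop)
    (H : ∀ ρ : ℝ, (R.rho0 : ℝ) ≤ ρ → ρ ≤ R.rho1 → ∀ dt : (Fin 3 → ℤ) → ℝ, S dt →
        (∀ q, castW R.lo q ≤ dt (holeVertex 0 q) ∧ dt (holeVertex 0 q) ≤ castW R.hi q) → ((R.loC : ℝ) ≤ dt 0 ∧ dt 0 ≤ R.hiC) →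
        IsChartRealisable ρ dt → (∀ p ∈ stencil 0, 0 < dt p) → poleSum dt 0 ≤ poleSum dt 1 → poleSum dt 0 ≤ poleSum dt 2 →
        (∀ a : Fin 3, dt (holeVertex 0 (a, true)) ≤ dt (holeVertex 0 (a, false))) →
        (∀ a : Fin 3, dt (holeVertex 0 (a, true)) ^ 2 - dt 0 ^ 2 + 2 * (cell.lo a : ℝ) * R.rho0 * dt 0 ≤ (R.rho1 : ℝ) ^ 2) →
        (∀ (a : Fin 3) (b : Bool), dt (holeVertex 0 (a, b)) ^ 2 - dt 0 ^ 2 - 2 * (cell.hi a : ℝ) * R.rho1 * dt 0 ≤ (R.rho1 : ℝ) ^ 2) →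
        feetHoleCost 160 (3 / 100) ρ dt 0 ≤ domCapK u 160 (3 / 100) ρ (chargeDepth ρ dt 0))
    (hs : R.symm12 = true) (hρ0 : 0 < R.rho0) :
    ∀ ρ : ℝ, (R.rho0 : ℝ) ≤ ρ → ρ ≤ R.rho1 → ∀ dt : (Fin 3 → ℤ) → ℝ, S (tupleRelabel 1 0 dt) →
      (∀ q, castW R.lo q ≤ dt (holeVertex 0 q) ∧ dt (holeVertex 0 q) ≤ castW R.hi q) → ((R.loC : ℝ) ≤ dt 0 ∧ dt 0 ≤ R.hiC) →
      IsChartRealisable ρ dt → (∀ p ∈ stencil 0, 0 < dt p) → poleSum dt 0 ≤ poleSum dt 1 → poleSum dt 0 ≤ poleSum dt 2 →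
      (∀ a : Fin 3, dt (holeVertex 0 (a, true)) ≤ dt (holeVertex 0 (a, false))) →
      (∀ a : Fin 3, dt (holeVertex 0 (a, true)) ^ 2 - dt 0 ^ 2 + 2 * (cell.swap12.lo a : ℝ) * R.rho0 * dt 0 ≤ (R.rho1 : ℝ) ^ 2) →
      (∀ (a : Fin 3) (b : Bool), dt (holeVertex 0 (a, b)) ^ 2 - dt 0 ^ 2 - 2 * (cell.swap12.hi a : ℝ) * R.rho1 * dt 0 ≤ (R.rho1 : ℝ) ^ 2) →
      feetHoleCost 160 (3 / 100) ρ dt 0 ≤ domCapK u 160 (3 / 100) ρ (chargeDepth ρ dt 0) := by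
  intro ρ h₀ h₁ dt hS hbox hC hreal hpos hch1 hch2 hchp hlo hhi
  have hρ : (0 : ℝ) < ρ := lt_of_lt_of_le (by exact_mod_cast hρ0) h₀
  have hv : ∀ (a : Fin 3) (b : Bool), tupleRelabel 1 0 dt (holeVertex 0 (a, b)) = dt (holeVertex 0 (axp 1 a, b)) := fun a b => by
    rw [tupleRelabel_vertex, relabel_one_zero]
  have h0 : tupleRelabel 1 0 dt 0 = dt 0 := tupleRelabel_zero 1 0 dt
  have hp0 : poleSum (tupleRelabel 1 0 dt) 0 = poleSum dt 0 := by rw [poleSum_tupleRelabel, axp_one.1]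
  have hp1 : poleSum (tupleRelabel 1 0 dt) 1 = poleSum dt 2 := by rw [poleSum_tupleRelabel, axp_one.2.1]
  have hp2 : poleSum (tupleRelabel 1 0 dt) 2 = poleSum dt 1 := by rw [poleSum_tupleRelabel, axp_one.2.2]
  have hbox' : ∀ q, castW R.lo q ≤ tupleRelabel 1 0 dt (holeVertex 0 q) ∧ tupleRelabel 1 0 dt (holeVertex 0 q) ≤ castW R.hi q := by
    intro q
    have hb := hbox (relabel 1 0 q)
    rw [castW_apply, castW_apply, (R.symm12_spec hs q).1, (R.symm12_spec hs q).2] at hb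
    rw [tupleRelabel_vertex, castW_apply, castW_apply]
    exact hb
  have hC' : (R.loC : ℝ) ≤ tupleRelabel 1 0 dt 0 ∧ tupleRelabel 1 0 dt 0 ≤ R.hiC := by rw [h0]; exact hC
  have hchp' : ∀ a : Fin 3, tupleRelabel 1 0 dt (holeVertex 0 (a, true)) ≤ tupleRelabel 1 0 dt (holeVertex 0 (a, false)) := fun a => by
    rw [hv, hv]; exact hchp (axp 1 a)
  have hlo' : ∀ a : Fin 3, tupleRelabel 1 0 dt (holeVertex 0 (a, true)) ^ 2 - tupleRelabel 1 0 dt 0 ^ 2 +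
      2 * (cell.lo a : ℝ) * R.rho0 * tupleRelabel 1 0 dt 0 ≤ (R.rho1 : ℝ) ^ 2 := fun a => by
    rw [hv, h0, ← Box3.swap12_lo cell a]; exact hlo (axp 1 a)
  have hhi' : ∀ (a : Fin 3) (b : Bool), tupleRelabel 1 0 dt (holeVertex 0 (a, b)) ^ 2 - tupleRelabel 1 0 dt 0 ^ 2 -
      2 * (cell.hi a : ℝ) * R.rho1 * tupleRelabel 1 0 dt 0 ≤ (R.rho1 : ℝ) ^ 2 := fun a b => by
    rw [hv, h0, ← Box3.swap12_hi cell a]; exact hhi (axp 1 a) b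
  have hlaw := H ρ h₀ h₁ (tupleRelabel 1 0 dt) hS hbox' hC' (isChartRealisable_tupleRelabel 1 0 hreal)
    (pos_tupleRelabel 1 0 hpos) (by rw [hp0, hp1]; exact hch2) (by rw [hp0, hp2]; exact hch1) hchp' hlo' hhi'
  rwa [feetHoleCost_tupleRelabel, chargeDepth_tupleRelabel 1 0 hρ.ne'] at hlaw

end Swap

end Summit.AtomisticToContinuum.Crystallization.Theorems.ChargedEnergyGapChartDial
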